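import Summits.FinalStateConjecture.FinalStateConjecture.Theses.TemporalBandLiouville
import HarnessLib.Audit

/-!
# Birth skeleton (BC3) for crux `TemporalBandLiouville.KerrExteriorsSettle` (stmt-FinalStateConjecture-18039)

Piece P1 of the typed decomposition (BC2 redirect) of `TemporalBandLiouville.StationaryLimitReduction`
(item 10173), filed by the crux-strategist seat planner-cstrat-stmt-FinalStateConjecture-10173-r1-0, 2026-08-17.

## The crux (FIXED, by name)

P1 = KERR EXTERIORS SETTLE (conditional pointwise `C⁰` settling): IF every member of X's class (the seven-clause
antecedent of `EternalExteriorStationary`, verbatim) is an isometrically embedded piece of an ingoing Kerr–Schild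
Kerr spacetime (`0 < M'`, `|a'| ≤ M'`), THEN every maximal vacuum Cauchy development of every admissible datum with
complete `𝓘⁺` settles in `C⁰` (the body of `EternalPapapetrou.CompleteScriSettlesC0`, item 17273, verbatim).

## The cut — CRITICAL ELEMENT IN HARMONIC GAUGE + THE NO-GEON LIOUVILLE THEOREM

* S1 `stub_harmonicLaSalleDichotomy` (HARDEST — "stability in the large"): every maximal vacuum Cauchy development
  of admissible data with complete `𝓘⁺` EITHER settles in `C⁰` (T's conclusion verbatim) OR X's class has a
  NON-KERR member (an eternal, two-sided `C^k`-bounded, non-radiating harmonic-gauge vacuum black-hole exterior on an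
  excised cylinder which is not an embedded Kerr piece — verbatim the negation of P1's antecedent instance) OR the
  HORIZONLESS sibling class has a NON-STATIONARY member (an eternal harmonic-gauge vacuum metric `G` on all of `ℝ⁴`:
  `IsMetricOn G univ`, slices uniformly spacelike, `Ric = 0`, harmonic gauge, all `C^k` norms of `G`, `G⁻¹`
  bounded, stationary-rate fall-off on `{|x⃗| ≥ 1}` — a vacuum breather / geon). Content the prover must supply:
  (i) PRECOMPACTNESS of late-time translates of the d.o.c. of a non-settling development in comoving harmonic
  gauge, with excision inside the apparent horizon around each concentration region (two-sided `C^k` bounds) and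
  no excision where no horizon forms; (ii) two-sided NON-RADIATION of the `ω`-limits at X's stationary rates
  (Bondi mass non-increasing and bounded below ⇒ no outgoing flux in the limit; asymptotic flatness of the datum ⇒
  no incoming radiation at late advanced time; gauge radiation excluded by the comoving harmonic normalisation), so
  every limit lies in X's class or in the horizonless class; (iii) the CONVERSE DYNAMICS (LaSalle): if every
  black-hole limit is an embedded Kerr piece and every horizonless limit is `t`-independent — hence FLAT by
  Lichnerowicz's theorem (stationary geodesically complete vacuum with a complete AF slice: Komar = ADM mass = 0,
  positive-mass rigidity; classical) — then isolation of the Kerr family among limits + monotone Bondi mass give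
  parameter convergence along the flow, finitely many sublinearly separating holes, and horizon-normalised
  Kerr–Schild charts exhausting `O` in `C⁰` with rays in `closure O` and future orientation. The three are ONE typed
  statement because the tree has no `ω`-limit object for developments (cf. `Cruxes/CompleteScriSettlesC0/Lines/birth.lean`,
  the sibling cut over the far-chart class). Logical position: P1 ⇒ S1 (S1 is never stronger than the crux);
  S1 ∧ S2 ⇒ P1 (proved here).
* S2 `stub_horizonlessLiouville` (open — "no vacuum breathers on `ℝ⁴`", the horizonless sibling of X which the
  route header leaves to the no-geon cards): a member of the horizonless class is `t`-independent. Known inputs: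
  periodic / non-radiating ⇒ stationary NEAR INFINITY (Papapetrou 1957, Bičák–Scholtz–Tod 2010, Alexakis–Schlue
  2015); inward continuation is free where `∂ₜ` is timelike; the residual is an eternal horizonless vacuum
  configuration with an ergoregion or trapping. (Standing gauge waves `sin ωt · sin ωρ/ρ` on Minkowski are
  excluded by the `‖DG‖ ≤ C/ρ²` clause, as in X.)

Composition `KerrExteriorsSettle_of : Sig.stub_harmonicLaSalleDichotomy → Sig.stub_horizonlessLiouville →
KerrExteriorsSettle` (kernel-checked, no `sorry` of its own): under P1's antecedent the second disjunct of S1 is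
absurd, under S2 the third; the first is the goal. Registered stub signatures are DEF-FREE over this file.

## Disproof used / negatives / barriers

No `Disproof.lean` exists for this (new) item. Negatives index (2026-08-17): one unrelated entry. Barriers:
`SbierskiTrappingObstruction` / `PriceLawTail` — no decay RATE is asserted (`C⁰` exhaustion, qualitative
`ω`-limits), but S1's compactness leg needs SOME uniform control up to the excision and that is where trapping /
tails are met; `AretakisInstability` — extremal end states: T allows `|aᵢ| ≤ Mᵢ` and asks `C⁰` only, yet S1's
compactness at a degenerate horizon is the named residual; Burnett weak limits exiting vacuum (arXiv:1907.10743)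
are why S1 states two-sided `C^k` bounds as part of the limit class; `NonSmoothNullInfinity` — stationary-rate
fall-off is asked of the LIMITS only. Refuter read-back of T (rreview1 on item 17273) honoured: `IsMaximal` and
complete `𝓘⁺` are hypotheses of S1; T is all-data strength and so is S1's first disjunct.
-/

set_option linter.dupNamespace false

namespace Summit.FinalStateConjecture.FinalStateConjecture.Cruxes.KerrExteriorsSettle.Birth

open scoped BigOperators Topology Manifold Classical MeasureTheory ProbabilityTheory Matrix InnerProductSpace ComplexConjugate ContinuousMap
open Filter Set Function TopologicalSpace MeasureTheory

/-! ## The two registered stubs -/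

/-- **Registered stub 1 — the harmonic LaSalle dichotomy (critical element; HARDEST).** A maximal vacuum Cauchy
development of admissible data with complete `𝓘⁺` settles in `C⁰`, or X's class has a non-Kerr member, or the
horizonless harmonic class has a non-stationary member. -/
theorem stub_harmonicLaSalleDichotomy :
    ∀ (X : Type) [TopologicalSpace X] [ChartedSpace Literature.Geometry.Lorentzian.E3 X] [IsManifold (𝓡 3) (⊤ : ℕ∞) X] [T2Space X] [SecondCountableTopology X] [ConnectedSpace X], ∀ D ∈ Literature.Geometry.Lorentzian.admissibleVacuumData X, ∀ 𝒟 : Literature.Geometry.Lorentzian.VacuumCauchyDevelopment D, 𝒟.IsMaximal → Summit.FinalStateConjecture.HasCompleteNullInfinity 𝒟.toCauchyDevelopment → (∃ (O : Set 𝒟.carrier) (d : Literature.Geometry.Lorentzian.FinalStateDecomposition 𝒟.toSpacetime O 0), O = Summit.FinalStateConjecture.exteriorOf 𝒟.toCauchyDevelopment d.charted ∧ Summit.FinalStateConjecture.RaysStayInClosure 𝒟.toCauchyDevelopment O ∧ Summit.FinalStateConjecture.HasExhaustiveCharts d ∧ Summit.FinalStateConjecture.IsFutureOriented d) ∨ (∃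 (a r₀ : ℝ) (G : Literature.Geometry.Lorentzian.E4 → Literature.Geometry.Lorentzian.E4 →L[ℝ] Literature.Geometry.Lorentzian.E4 →L[ℝ] ℝ), ((0 < r₀ ∧ Literature.Geometry.Lorentzian.MetricCoord.IsMetricOn G (Literature.Geometry.Lorentzian.Kerr.region a r₀ : Set Literature.Geometry.Lorentzian.E4) ∧ (∃ c₀ δ : ℝ, 0 < c₀ ∧ 0 < δ ∧ ∀ x ∈ Literature.Geometry.Lorentzian.Kerr.region a r₀, (Literature.Geometry.Lorentzian.E4.dx 0) (Literature.Geometry.Lorentzian.MetricCoord.sharpAt G x (Literature.Geometry.Lorentzian.E4.dx 0)) ≤ -c₀ ∧ (Literature.Geometry.Lorentzian.Kerr.radius a x < r₀ + δ → (fderiv ℝ (Literature.Geometry.Lorentzian.Kerr.radius a) x) (Literature.Geometry.Lorentzian.MetricCoord.sharpAt G x (fderiv ℝ (Literature.Geometry.Lorentzian.Kerr.radius a) x)) ≤ -c₀ ∧ c₀ ≤ (Literature.Geometry.Lorentzian.E4.dx 0) (Literature.Geometry.Lorentzian.MetricCoord.sharpAt G x (fderiv ℝ (Literature.Geometry.Lorentzian.Kerr.radius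 a) x)))) ∧ (∀ x ∈ Literature.Geometry.Lorentzian.Kerr.region a r₀, Literature.Geometry.Lorentzian.MetricCoord.ricAt G x = 0) ∧ (∀ x ∈ Literature.Geometry.Lorentzian.Kerr.region a r₀, ∑ β : Fin 4, Literature.Geometry.Lorentzian.MetricCoord.chrAt G x (Literature.Geometry.Lorentzian.MetricCoord.sharpAt G x (Literature.Geometry.Lorentzian.E4.dx β)) (Literature.Geometry.Lorentzian.E4.basisVector β) = 0) ∧ (∀ k : ℕ, ∃ C : ℝ, ∀ x ∈ Literature.Geometry.Lorentzian.Kerr.region a r₀, ‖iteratedFDeriv ℝ k G x‖ ≤ C ∧ ‖Literature.Geometry.Lorentzian.MetricCoord.sharpAt G x‖ ≤ C) ∧ (∃ C : ℝ, ∀ x ∈ Literature.Geometry.Lorentzian.Kerr.region a r₀, ‖G x - Literature.Geometry.Lorentzian.Minkowski.bilin‖ ≤ C / Literature.Geometry.Lorentzian.E4.spatialNorm x ∧ ‖iteratedFDeriv ℝ 1 G x‖ ≤ C / Literature.Geometry.Lorentzian.E4.spatialNorm x ^ 2 ∧ ‖iteratedFDeriv ℝ 2 G x‖ ≤ C / Literature.Geometry.Lorentzian.E4.spatialNorm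 x ^ 3))) ∧ ¬ (∃ (M' a' : ℝ) (Ψ : Literature.Geometry.Lorentzian.E4 → Literature.Geometry.Lorentzian.E4), 0 < M' ∧ |a'| ≤ M' ∧ ContDiffOn ℝ (⊤ : ℕ∞) Ψ (Literature.Geometry.Lorentzian.Kerr.region a r₀ : Set Literature.Geometry.Lorentzian.E4) ∧ Set.InjOn Ψ (Literature.Geometry.Lorentzian.Kerr.region a r₀ : Set Literature.Geometry.Lorentzian.E4) ∧ (∀ x ∈ Literature.Geometry.Lorentzian.Kerr.region a r₀, 0 < Literature.Geometry.Lorentzian.Kerr.radius a' (Ψ x)) ∧ ∀ x ∈ Literature.Geometry.Lorentzian.Kerr.region a r₀, ∀ v w : Literature.Geometry.Lorentzian.E4, G x v w = Literature.Geometry.Lorentzian.Kerr.bilin M' a' (Ψ x) (fderiv ℝ Ψ x v) (fderiv ℝ Ψ x w))) ∨ (∃ G : Literature.Geometry.Lorentzian.E4 → Literature.Geometry.Lorentzian.E4 →L[ℝ] Literature.Geometry.Lorentzian.E4 →L[ℝ] ℝ, (Literature.Geometry.Lorentzian.MetricCoord.IsMetricOn G (Set.univ : Set Literature.Geometry.Lorentzian.E4)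 ∧ (∃ c₀ : ℝ, 0 < c₀ ∧ ∀ x : Literature.Geometry.Lorentzian.E4, (Literature.Geometry.Lorentzian.E4.dx 0) (Literature.Geometry.Lorentzian.MetricCoord.sharpAt G x (Literature.Geometry.Lorentzian.E4.dx 0)) ≤ -c₀) ∧ (∀ x : Literature.Geometry.Lorentzian.E4, Literature.Geometry.Lorentzian.MetricCoord.ricAt G x = 0) ∧ (∀ x : Literature.Geometry.Lorentzian.E4, ∑ β : Fin 4, Literature.Geometry.Lorentzian.MetricCoord.chrAt G x (Literature.Geometry.Lorentzian.MetricCoord.sharpAt G x (Literature.Geometry.Lorentzian.E4.dx β)) (Literature.Geometry.Lorentzian.E4.basisVector β) = 0) ∧ (∀ k : ℕ, ∃ C : ℝ, ∀ x : Literature.Geometry.Lorentzian.E4, ‖iteratedFDeriv ℝ k G x‖ ≤ C ∧ ‖Literature.Geometry.Lorentzian.MetricCoord.sharpAt G x‖ ≤ C) ∧ (∃ C : ℝ, ∀ x : Literature.Geometry.Lorentzian.E4, 1 ≤ Literature.Geometry.Lorentzian.E4.spatialNorm x → ‖G x - Literature.Geometry.Lorentzian.Minkowski.bilin‖ ≤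 C / Literature.Geometry.Lorentzian.E4.spatialNorm x ∧ ‖iteratedFDeriv ℝ 1 G x‖ ≤ C / Literature.Geometry.Lorentzian.E4.spatialNorm x ^ 2 ∧ ‖iteratedFDeriv ℝ 2 G x‖ ≤ C / Literature.Geometry.Lorentzian.E4.spatialNorm x ^ 3)) ∧ ¬ (∀ (x : Literature.Geometry.Lorentzian.E4) (s : ℝ), G (x + s • Literature.Geometry.Lorentzian.E4.basisVector 0) = G x)) := by
  sorry

/-- **Registered stub 2 — the horizonless eternal Liouville theorem ("no vacuum breathers on `ℝ⁴`").** An eternal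
harmonic-gauge vacuum metric on all of `ℝ⁴` with uniformly spacelike slices, all `C^k` norms bounded and
stationary-rate fall-off on `{|x⃗| ≥ 1}` is `t`-independent. -/
theorem stub_horizonlessLiouville :
    ∀ (G : Literature.Geometry.Lorentzian.E4 → Literature.Geometry.Lorentzian.E4 →L[ℝ] Literature.Geometry.Lorentzian.E4 →L[ℝ] ℝ), (Literature.Geometry.Lorentzian.MetricCoord.IsMetricOn G (Set.univ : Set Literature.Geometry.Lorentzian.E4) ∧ (∃ c₀ : ℝ, 0 < c₀ ∧ ∀ x : Literature.Geometry.Lorentzian.E4, (Literature.Geometry.Lorentzian.E4.dx 0) (Literature.Geometry.Lorentzian.MetricCoord.sharpAt G x (Literature.Geometry.Lorentzian.E4.dx 0)) ≤ -c₀) ∧ (∀ x : Literature.Geometry.Lorentzian.E4, Literature.Geometry.Lorentzian.MetricCoord.ricAt G x = 0) ∧ (∀ x : Literature.Geometry.Lorentzian.E4, ∑ β : Fin 4, Literature.Geometry.Lorentzian.MetricCoord.chrAt G x (Literature.Geometry.Lorentzian.MetricCoord.sharpAt G x (Literature.Geometry.Lorentzian.E4.dx β)) (Literature.Geometry.Lorentzian.E4.basisVector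 β) = 0) ∧ (∀ k : ℕ, ∃ C : ℝ, ∀ x : Literature.Geometry.Lorentzian.E4, ‖iteratedFDeriv ℝ k G x‖ ≤ C ∧ ‖Literature.Geometry.Lorentzian.MetricCoord.sharpAt G x‖ ≤ C) ∧ (∃ C : ℝ, ∀ x : Literature.Geometry.Lorentzian.E4, 1 ≤ Literature.Geometry.Lorentzian.E4.spatialNorm x → ‖G x - Literature.Geometry.Lorentzian.Minkowski.bilin‖ ≤ C / Literature.Geometry.Lorentzian.E4.spatialNorm x ∧ ‖iteratedFDeriv ℝ 1 G x‖ ≤ C / Literature.Geometry.Lorentzian.E4.spatialNorm x ^ 2 ∧ ‖iteratedFDeriv ℝ 2 G x‖ ≤ C / Literature.Geometry.Lorentzian.E4.spatialNorm x ^ 3)) → ∀ (x : Literature.Geometry.Lorentzian.E4) (s : ℝ), G (x + s • Literature.Geometry.Lorentzian.E4.basisVector 0) = G x := by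
  sorry

/-! ## Registered stub signatures (verbatim, as named `Prop`s) -/
namespace Sig

/-- Registered signature of `stub_harmonicLaSalleDichotomy` (verbatim). -/
abbrev stub_harmonicLaSalleDichotomy : Prop :=
  ∀ (X : Type) [TopologicalSpace X] [ChartedSpace Literature.Geometry.Lorentzian.E3 X] [IsManifold (𝓡 3) (⊤ : ℕ∞) X] [T2Space X] [SecondCountableTopology X] [ConnectedSpace X], ∀ D ∈ Literature.Geometry.Lorentzian.admissibleVacuumData X, ∀ 𝒟 : Literature.Geometry.Lorentzian.VacuumCauchyDevelopment D, 𝒟.IsMaximal → Summit.FinalStateConjecture.HasCompleteNullInfinity 𝒟.toCauchyDevelopment → (∃ (O : Set 𝒟.carrier) (d : Literature.Geometry.Lorentzian.FinalStateDecomposition 𝒟.toSpacetime O 0), O = Summit.FinalStateConjecture.exteriorOf 𝒟.toCauchyDevelopment d.charted ∧ Summit.FinalStateConjecture.RaysStayInClosure 𝒟.toCauchyDevelopment O ∧ Summit.FinalStateConjecture.HasExhaustiveCharts d ∧ Summit.FinalStateConjecture.IsFutureOriented d) ∨ (∃ (a r₀ : ℝ) (G : Literature.Geometry.Lorentzian.E4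 → Literature.Geometry.Lorentzian.E4 →L[ℝ] Literature.Geometry.Lorentzian.E4 →L[ℝ] ℝ), ((0 < r₀ ∧ Literature.Geometry.Lorentzian.MetricCoord.IsMetricOn G (Literature.Geometry.Lorentzian.Kerr.region a r₀ : Set Literature.Geometry.Lorentzian.E4) ∧ (∃ c₀ δ : ℝ, 0 < c₀ ∧ 0 < δ ∧ ∀ x ∈ Literature.Geometry.Lorentzian.Kerr.region a r₀, (Literature.Geometry.Lorentzian.E4.dx 0) (Literature.Geometry.Lorentzian.MetricCoord.sharpAt G x (Literature.Geometry.Lorentzian.E4.dx 0)) ≤ -c₀ ∧ (Literature.Geometry.Lorentzian.Kerr.radius a x < r₀ + δ → (fderiv ℝ (Literature.Geometry.Lorentzian.Kerr.radius a) x) (Literature.Geometry.Lorentzian.MetricCoord.sharpAt G x (fderiv ℝ (Literature.Geometry.Lorentzian.Kerr.radius a) x)) ≤ -c₀ ∧ c₀ ≤ (Literature.Geometry.Lorentzian.E4.dx 0) (Literature.Geometry.Lorentzian.MetricCoord.sharpAt G x (fderiv ℝ (Literature.Geometry.Lorentzian.Kerr.radius a) x)))) ∧ (∀ x ∈ Literature.Geometry.Lorentzian.Kerr.region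 a r₀, Literature.Geometry.Lorentzian.MetricCoord.ricAt G x = 0) ∧ (∀ x ∈ Literature.Geometry.Lorentzian.Kerr.region a r₀, ∑ β : Fin 4, Literature.Geometry.Lorentzian.MetricCoord.chrAt G x (Literature.Geometry.Lorentzian.MetricCoord.sharpAt G x (Literature.Geometry.Lorentzian.E4.dx β)) (Literature.Geometry.Lorentzian.E4.basisVector β) = 0) ∧ (∀ k : ℕ, ∃ C : ℝ, ∀ x ∈ Literature.Geometry.Lorentzian.Kerr.region a r₀, ‖iteratedFDeriv ℝ k G x‖ ≤ C ∧ ‖Literature.Geometry.Lorentzian.MetricCoord.sharpAt G x‖ ≤ C) ∧ (∃ C : ℝ, ∀ x ∈ Literature.Geometry.Lorentzian.Kerr.region a r₀, ‖G x - Literature.Geometry.Lorentzian.Minkowski.bilin‖ ≤ C / Literature.Geometry.Lorentzian.E4.spatialNorm x ∧ ‖iteratedFDeriv ℝ 1 G x‖ ≤ C / Literature.Geometry.Lorentzian.E4.spatialNorm x ^ 2 ∧ ‖iteratedFDeriv ℝ 2 G x‖ ≤ C / Literature.Geometry.Lorentzian.E4.spatialNorm x ^ 3))) ∧ ¬ (∃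 (M' a' : ℝ) (Ψ : Literature.Geometry.Lorentzian.E4 → Literature.Geometry.Lorentzian.E4), 0 < M' ∧ |a'| ≤ M' ∧ ContDiffOn ℝ (⊤ : ℕ∞) Ψ (Literature.Geometry.Lorentzian.Kerr.region a r₀ : Set Literature.Geometry.Lorentzian.E4) ∧ Set.InjOn Ψ (Literature.Geometry.Lorentzian.Kerr.region a r₀ : Set Literature.Geometry.Lorentzian.E4) ∧ (∀ x ∈ Literature.Geometry.Lorentzian.Kerr.region a r₀, 0 < Literature.Geometry.Lorentzian.Kerr.radius a' (Ψ x)) ∧ ∀ x ∈ Literature.Geometry.Lorentzian.Kerr.region a r₀, ∀ v w : Literature.Geometry.Lorentzian.E4, G x v w = Literature.Geometry.Lorentzian.Kerr.bilin M' a' (Ψ x) (fderiv ℝ Ψ x v) (fderiv ℝ Ψ x w))) ∨ (∃ G : Literature.Geometry.Lorentzian.E4 → Literature.Geometry.Lorentzian.E4 →L[ℝ] Literature.Geometry.Lorentzian.E4 →L[ℝ] ℝ, (Literature.Geometry.Lorentzian.MetricCoord.IsMetricOn G (Set.univ : Set Literature.Geometry.Lorentzian.E4) ∧ (∃ c₀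 : ℝ, 0 < c₀ ∧ ∀ x : Literature.Geometry.Lorentzian.E4, (Literature.Geometry.Lorentzian.E4.dx 0) (Literature.Geometry.Lorentzian.MetricCoord.sharpAt G x (Literature.Geometry.Lorentzian.E4.dx 0)) ≤ -c₀) ∧ (∀ x : Literature.Geometry.Lorentzian.E4, Literature.Geometry.Lorentzian.MetricCoord.ricAt G x = 0) ∧ (∀ x : Literature.Geometry.Lorentzian.E4, ∑ β : Fin 4, Literature.Geometry.Lorentzian.MetricCoord.chrAt G x (Literature.Geometry.Lorentzian.MetricCoord.sharpAt G x (Literature.Geometry.Lorentzian.E4.dx β)) (Literature.Geometry.Lorentzian.E4.basisVector β) = 0) ∧ (∀ k : ℕ, ∃ C : ℝ, ∀ x : Literature.Geometry.Lorentzian.E4, ‖iteratedFDeriv ℝ k G x‖ ≤ C ∧ ‖Literature.Geometry.Lorentzian.MetricCoord.sharpAt G x‖ ≤ C) ∧ (∃ C : ℝ, ∀ x : Literature.Geometry.Lorentzian.E4, 1 ≤ Literature.Geometry.Lorentzian.E4.spatialNorm x → ‖G x - Literature.Geometry.Lorentzian.Minkowski.bilin‖ ≤ C / Literature.Geometry.Lorentzian.E4.spatialNorm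 x ∧ ‖iteratedFDeriv ℝ 1 G x‖ ≤ C / Literature.Geometry.Lorentzian.E4.spatialNorm x ^ 2 ∧ ‖iteratedFDeriv ℝ 2 G x‖ ≤ C / Literature.Geometry.Lorentzian.E4.spatialNorm x ^ 3)) ∧ ¬ (∀ (x : Literature.Geometry.Lorentzian.E4) (s : ℝ), G (x + s • Literature.Geometry.Lorentzian.E4.basisVector 0) = G x))

/-- Registered signature of `stub_horizonlessLiouville` (verbatim). -/
abbrev stub_horizonlessLiouville : Prop :=
  ∀ (G : Literature.Geometry.Lorentzian.E4 → Literature.Geometry.Lorentzian.E4 →L[ℝ] Literature.Geometry.Lorentzian.E4 →L[ℝ] ℝ), (Literature.Geometry.Lorentzian.MetricCoord.IsMetricOn G (Set.univ : Set Literature.Geometry.Lorentzian.E4) ∧ (∃ c₀ : ℝ, 0 < c₀ ∧ ∀ x : Literature.Geometry.Lorentzian.E4, (Literature.Geometry.Lorentzian.E4.dx 0) (Literature.Geometry.Lorentzian.MetricCoord.sharpAt G x (Literature.Geometry.Lorentzian.E4.dx 0)) ≤ -c₀) ∧ (∀ x : Literature.Geometry.Lorentzian.E4, Literature.Geometry.Lorentzian.MetricCoord.ricAt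 G x = 0) ∧ (∀ x : Literature.Geometry.Lorentzian.E4, ∑ β : Fin 4, Literature.Geometry.Lorentzian.MetricCoord.chrAt G x (Literature.Geometry.Lorentzian.MetricCoord.sharpAt G x (Literature.Geometry.Lorentzian.E4.dx β)) (Literature.Geometry.Lorentzian.E4.basisVector β) = 0) ∧ (∀ k : ℕ, ∃ C : ℝ, ∀ x : Literature.Geometry.Lorentzian.E4, ‖iteratedFDeriv ℝ k G x‖ ≤ C ∧ ‖Literature.Geometry.Lorentzian.MetricCoord.sharpAt G x‖ ≤ C) ∧ (∃ C : ℝ, ∀ x : Literature.Geometry.Lorentzian.E4, 1 ≤ Literature.Geometry.Lorentzian.E4.spatialNorm x → ‖G x - Literature.Geometry.Lorentzian.Minkowski.bilin‖ ≤ C / Literature.Geometry.Lorentzian.E4.spatialNorm x ∧ ‖iteratedFDeriv ℝ 1 G x‖ ≤ C / Literature.Geometry.Lorentzian.E4.spatialNorm x ^ 2 ∧ ‖iteratedFDeriv ℝ 2 G x‖ ≤ C / Literature.Geometry.Lorentzian.E4.spatialNorm x ^ 3)) → ∀ (x : Literature.Geometry.Lorentzian.E4) (s : ℝ), G (x + s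 • Literature.Geometry.Lorentzian.E4.basisVector 0) = G x

end Sig

/-- The registered signatures ARE the statements of the two `stub_*` theorems (ascription; no `sorry` of their own). -/
example : Sig.stub_harmonicLaSalleDichotomy := stub_harmonicLaSalleDichotomy
example : Sig.stub_horizonlessLiouville := stub_horizonlessLiouville

/-! ## The composition: the crux BY NAME from the two stub statements (no `sorry`) -/

/-- **`KerrExteriorsSettle` from the two stubs.** Under the crux's antecedent (every member of X's class is an
embedded Kerr piece) the second disjunct of the dichotomy is absurd; under the horizonless Liouville theorem the
third; the first is the `C⁰` settling. -/
theorem KerrExteriorsSettle_of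
    (h₁ : Sig.stub_harmonicLaSalleDichotomy) (h₂ : Sig.stub_horizonlessLiouville) :
    Summit.FinalStateConjecture.FinalStateConjecture.Theses.TemporalBandLiouville.KerrExteriorsSettle := by
  intro hKerr X i₁ i₂ i₃ i₄ i₅ i₆ D hD 𝒟 hmax hcomp
  rcases h₁ X D hD 𝒟 hmax hcomp with h | ⟨a, r₀, G, hG, hnot⟩ | ⟨G, hG, hnot⟩
  · exact h
  · exact (hnot (hKerr a r₀ G hG)).elim
  · exact (hnot (h₂ G hG)).elim

end Summit.FinalStateConjecture.FinalStateConjecture.Cruxes.KerrExteriorsSettle.Birth
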